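import Mathlib
import Summits.Ventures.HodgeRepro2.T5IsotypicProduct
import Summits.Ventures.HodgeRepro2.T5TensorSeparation

/-!
# The `G₂`-action descends to `S[π₁]`, and a `G₁ × G₂`-map `S → π₁ ⊠ π′` descends with it

Blind cell `pub-hodge-repro2`, seat p8 (gen 6), Tier-5 kernel support for the N3 record
(MVW chap. 2 III.3–III.5; §N3.12.4 (s1)–(s2) and N3.10.3).  The bookkeeping that the record
supplies in prose between `T5TensorSeparation` (p391188: a map `Φ : S → π₁ ⊗ π′` factors through
`S[π₁] = S ⧸ S(π₁)`) and the smooth-level statements of `T5SmoothPassage` / `T5HoweSmooth`: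

* `smul_mem_isotypicKer` — `S(π₁) = ⋂ ker f` is stable under every operator commuting with `G₁`
  (`f ∘ (r • ·)` is again a `G₁`-map to `π₁`), so the `G₂`-action descends to `S[π₁]`:
  `quotSmul r : S[π₁] →ₗ[R] S[π₁]`, `quotSmul_mk`;
* `instModuleIsotypicQuot` — `S[π₁]` as an `R₂`-module (`R₂ = H(G₂)⁺` or `k[G₂]`) with the
  descended action; it commutes with `R` (`instSMulCommClassIsotypicQuot` and its symmetric
  form) and is compatible with the `k`-structure (`instIsScalarTowerIsotypicQuot`);
* `liftΦ` — the descended map `S[π₁] →ₗ[R] π₁ ⊗[k] π′` (`Submodule.liftQ` along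
  `T5TensorSeparation.iInf_ker_le_ker`), `liftΦ_mk`, `liftΦ_ne_zero`, `liftΦ_equivariant`
  (the `R₂`-equivariance of `Φ` descends).

With these, `T5HoweSmooth.exists_surjective_of_equivariant` applies to `V = S[π₁]` literally once
`S[π₁]` is semisimple (`T5SmoothPassage` / `T5CornerAlgebra`) — the composition is recorded in
the next file.  What stays prose: smooth representations = non-degenerate Hecke modules; the
printed theorems.  Nothing arithmetic is asserted.

README §8(d): uses an L-value-free non-vanishing device: NO.
-/

namespace Summit.Ventures.HodgeRepro2.T5IsotypicQuotAction

open Summit.Ventures.HodgeRepro2.T5IsotypicProduct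
open Summit.Ventures.HodgeRepro2.T5TensorSeparation

section Descent

variable {R R₂ : Type*} [Ring R] [Ring R₂]
  {N : Type*} [AddCommGroup N] [Module R N]
  {S : Type*} [AddCommGroup S] [Module R S] [Module R₂ S] [SMulCommClass R₂ R S]

/-- `S(N) = ⋂_{f : S → N} ker f` is stable under every `R₂`-operator commuting with `R`. -/
theorem smul_mem_isotypicKer (r : R₂) {x : S} (hx : x ∈ isotypicKer R N S) :
    r • x ∈ isotypicKer R N S := by
  change x ∈ ⨅ f : S →ₗ[R] N, LinearMap.ker f at hx
  change r • x ∈ ⨅ f : S →ₗ[R] N, LinearMap.ker f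
  rw [Submodule.mem_iInf] at hx ⊢
  intro f
  have h := hx (f ∘ₗ DistribSMul.toLinearMap R S r)
  rw [LinearMap.mem_ker] at h ⊢
  exact h

variable (R N) in
/-- The descended operator `r • ·` on `S[N] = S ⧸ S(N)`, `R`-linear. -/
def quotSmul (r : R₂) : S ⧸ isotypicKer R N S →ₗ[R] S ⧸ isotypicKer R N S :=
  (isotypicKer R N S).mapQ (isotypicKer R N S) (DistribSMul.toLinearMap R S r)
    (fun _ hx => smul_mem_isotypicKer r hx)

/-- `quotSmul r (mk x) = mk (r • x)`. -/
@[simp] theorem quotSmul_mk (r : R₂) (x : S) :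
    quotSmul R N r (Submodule.Quotient.mk x) = Submodule.Quotient.mk (r • x) := rfl

/-- `S[N]` as an `R₂`-module with the descended action. -/
instance instModuleIsotypicQuot : Module R₂ (S ⧸ isotypicKer R N S) where
  smul r x := quotSmul R N r x
  one_smul x := by
    induction x using Submodule.Quotient.induction_on with
    | H z =>
      change quotSmul R N (1 : R₂) (Submodule.Quotient.mk z) = Submodule.Quotient.mk z
      rw [quotSmul_mk, one_smul]
  mul_smul r s x := by
    induction x using Submodule.Quotient.induction_on with
    | H z =>
      change quotSmul R N (r * s) (Submodule.Quotient.mk z) =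
        quotSmul R N r (quotSmul R N s (Submodule.Quotient.mk z))
      rw [quotSmul_mk, quotSmul_mk, quotSmul_mk, mul_smul]
  smul_zero r := map_zero (quotSmul R N r)
  smul_add r x y := map_add (quotSmul R N r) x y
  add_smul r s x := by
    induction x using Submodule.Quotient.induction_on with
    | H z =>
      change quotSmul R N (r + s) (Submodule.Quotient.mk z) =
        quotSmul R N r (Submodule.Quotient.mk z) + quotSmul R N s (Submodule.Quotient.mk z)
      rw [quotSmul_mk, quotSmul_mk, quotSmul_mk, add_smul, Submodule.Quotient.mk_add]
  zero_smul x := by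
    induction x using Submodule.Quotient.induction_on with
    | H z =>
      change quotSmul R N (0 : R₂) (Submodule.Quotient.mk z) = 0
      rw [quotSmul_mk, zero_smul, Submodule.Quotient.mk_zero]

/-- The descended action on a class: `r • mk x = mk (r • x)`. -/
@[simp] theorem isotypicQuot_smul_mk (r : R₂) (x : S) :
    (r • (Submodule.Quotient.mk x : S ⧸ isotypicKer R N S)) = Submodule.Quotient.mk (r • x) := rfl

/-- The descended `R₂`-action commutes with `R`. -/
instance instSMulCommClassIsotypicQuot : SMulCommClass R R₂ (S ⧸ isotypicKer R N S) where
  smul_comm a r x := by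
    induction x using Submodule.Quotient.induction_on with
    | H z =>
      change a • quotSmul R N r (Submodule.Quotient.mk z) = quotSmul R N r (a • Submodule.Quotient.mk z)
      rw [quotSmul_mk, ← Submodule.Quotient.mk_smul, ← Submodule.Quotient.mk_smul, quotSmul_mk,
        smul_comm r a z]

/-- The symmetric form. -/
instance instSMulCommClassIsotypicQuot' : SMulCommClass R₂ R (S ⧸ isotypicKer R N S) :=
  SMulCommClass.symm _ _ _

end Descent

section Tower

variable {k R R₂ : Type*} [Field k] [Ring R] [Algebra k R] [Ring R₂] [Algebra k R₂]
  {N : Type*} [AddCommGroup N] [Module R N]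
  {S : Type*} [AddCommGroup S] [Module R S] [Module k S] [IsScalarTower k R S]
  [Module R₂ S] [SMulCommClass R₂ R S] [IsScalarTower k R₂ S]

/-- The descended action is compatible with the `k`-structure of `S[N]`. -/
instance instIsScalarTowerIsotypicQuot : IsScalarTower k R₂ (S ⧸ isotypicKer R N S) where
  smul_assoc c r x := by
    induction x using Submodule.Quotient.induction_on with
    | H z =>
      change quotSmul R N (c • r) (Submodule.Quotient.mk z) = c • quotSmul R N r (Submodule.Quotient.mk z)
      rw [quotSmul_mk, quotSmul_mk, ← Submodule.Quotient.mk_smul, smul_assoc]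

end Tower

section Lift

variable {k R R₂ : Type*} [Field k] [Ring R] [Algebra k R] [Ring R₂]
  {N : Type*} [AddCommGroup N] [Module R N] [Module k N] [IsScalarTower k R N]
  {S : Type*} [AddCommGroup S] [Module R S] [Module R₂ S] [SMulCommClass R₂ R S]
  {P : Type*} [AddCommGroup P] [Module k P]

/-- The descended map `S[N] → N ⊗[k] P` of an `R`-linear `Φ : S → N ⊗[k] P`
(`T5TensorSeparation.iInf_ker_le_ker`: `Φ` kills `S(N)`). -/
def liftΦ (Φ : S →ₗ[R] TensorProduct k N P) : S ⧸ isotypicKer R N S →ₗ[R] TensorProduct k N P :=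
  (isotypicKer R N S).liftQ Φ (iInf_ker_le_ker Φ)

/-- `liftΦ Φ (mk x) = Φ x`. -/
@[simp] theorem liftΦ_mk (Φ : S →ₗ[R] TensorProduct k N P) (x : S) :
    liftΦ Φ (Submodule.Quotient.mk x) = Φ x := rfl

/-- `Φ ≠ 0 ⇒ liftΦ Φ ≠ 0`. -/
theorem liftΦ_ne_zero {Φ : S →ₗ[R] TensorProduct k N P} (hΦ : Φ ≠ 0) : liftΦ Φ ≠ 0 := by
  intro h0
  apply hΦ
  apply LinearMap.ext
  intro x
  have := LinearMap.congr_fun h0 (Submodule.Quotient.mk x)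
  simpa using this

/-- The `R₂`-equivariance of `Φ` descends to `liftΦ Φ`: if `Φ (r • x) = (1 ⊗ σ r) (Φ x)` for a
family of operators `σ r` on `P`, the same holds for `liftΦ Φ` with the descended action. -/
theorem liftΦ_equivariant (Φ : S →ₗ[R] TensorProduct k N P) (σ : R₂ → P →ₗ[k] P)
    (hequiv : ∀ (r : R₂) (x : S), Φ (r • x) = TensorProduct.map LinearMap.id (σ r) (Φ x))
    (r : R₂) (y : S ⧸ isotypicKer R N S) :
    liftΦ Φ (r • y) = TensorProduct.map LinearMap.id (σ r) (liftΦ Φ y) := by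
  induction y using Submodule.Quotient.induction_on with
  | H z =>
    rw [isotypicQuot_smul_mk, liftΦ_mk, liftΦ_mk]
    exact hequiv r z

end Lift

end Summit.Ventures.HodgeRepro2.T5IsotypicQuotAction
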